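import Literature.GroupTheory.Nilpotent.OperatorCommutatorWidthLayer
import HarnessLib

/-!
# Operator commutator width, II: a nilpotent normal subgroup normally generated by `n` elements
# inside a `d`-generator group

J.-P. Serre, *Galois Cohomology*, I §4.2, exercise 6, and J. D. Dixon, M. P. F. du Sautoy, A. Mann,
D. Segal, *Analytic pro-`p` groups* (2nd ed.), Ch. 1, Prop. 1.16–1.19, prove that in a NILPOTENT
group generated by `a₁, …, a_d` every element of the derived group is a product of `d` commutators
`⁅aᵢ, gᵢ⁆` (tree: `Literature.GroupTheory.Nilpotent.exists_eq_prod_commutator_of_isNilpotent`).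
This file proves the RELATIVE ("operator") version in which the ambient group need not be
nilpotent (layer calculus in `OperatorCommutatorWidthLayer.lean`):

* `exists_eq_prod_commutator_of_normalClosure_eq` — let `G` be a group generated by
  `g₁, …, g_d`, and `P ⊴ G` a NILPOTENT normal subgroup which is the normal closure of
  `y₁, …, y_n ∈ P`.  Then every element of `⁅P, G⁆` is of the shape
  `⁅s₁, g₁⁆ ⋯ ⁅s_d, g_d⁆ · ⁅y₁, u₁⁆ ⋯ ⁅y_n, u_n⁆` with all `sⱼ, uₐ ∈ P`
  (induction on the lower central series `γ_m(P)` of `P`: modulo `γ_{m+1}(P)` the commutators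
  `⁅γ_{m-1}(P), P⁆` are central IN `P`, and the identities `⁅w, c y c⁻¹⁆ = c ⁅c⁻¹ w c, y⁆ c⁻¹`,
  `c v c⁻¹ = v ⁅v⁻¹, c⁆`, `⁅k, c c'⁆ = ⁅k, c⁆ ⁅k, c'⁆ ⁅⁅k, c'⁆⁻¹, c⁆`, `⁅k, c⁻¹⁆ = ⁅c⁻¹ k c, c⁆⁻¹`
  replace the nilpotency of the ambient group);
* `exists_eq_prod_commutator_mul_pow_of_normalClosure_eq` — consequently every element of the
  subgroup generated by the `p`-th powers of elements of `P` and the commutators `⁅x, c⁆`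
  (`x ∈ P`, `c ∈ G`) is of the shape `⁅s₁, g₁⁆ ⋯ ⁅s_d, g_d⁆ · ⁅y₁, u₁⁆ ⋯ ⁅y_n, u_n⁆ · w ^ p`
  (`sⱼ, uₐ, w ∈ P`).

This is the uniform bound (in `d` and `n` only) behind the operator form of Serre's theorem
(`Literature/GroupTheory/ProP/OperatorFrattiniOpen.lean`): for a profinite group `G` and a closed
normal pro-`p` subgroup `P` that is topologically normally generated by finitely many elements, the
ABSTRACT subgroup `⟨x^p, ⁅x, c⁆ : x ∈ P, c ∈ G⟩` is closed and open in `P`.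
Pure group theory over Mathlib; proof-only (no definitions).
[cite: DixonDuSautoyMannSegal1999, Ch. 1 Prop. 1.16–1.19] [cite: SerreGaloisCohomology1997, I §4.2 ex. 6]
-/

namespace Literature.GroupTheory.Nilpotent

open Subgroup
open scoped commutatorElement

universe u

section Layer

variable {G : Type u} [Group G] {d n : ℕ} (g : Fin d → G) (y : Fin n → G)
  (P K' K N : Subgroup G) [N.Normal] [K.Normal]

/-- The `G`-part: `⁅k, c⁆` satisfies the layer predicate for every `k ∈ K` and every `c` in the
subgroup generated by the `gⱼ` (induction on `c`, using `⁅k, c c'⁆ = ⁅k, c⁆ ⁅k, c'⁆ ⁅⁅k, c'⁆⁻¹, c⁆`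
and `⁅k, c⁻¹⁆ = ⁅c⁻¹ k c, c⁆⁻¹`). [cite: DixonDuSautoyMannSegal1999, Ch. 1 Prop. 1.16] -/
theorem layer_commutator_of_mem_closure [P.Normal] (hKP : ∀ k ∈ K, ∀ x ∈ P, ⁅k, x⁆ ∈ N)
    (hK'P : ∀ w ∈ K', ∀ x ∈ P, ⁅w, x⁆ ∈ K) (hy : ∀ a, y a ∈ P) (hKle : K ≤ P) (hK'le : K' ≤ P)
    {c : G} (hc : c ∈ Subgroup.closure (Set.range g)) :
    ∀ k ∈ K, ∃ (δ : Fin d → G) (ε : Fin n → G), (∀ j, δ j ∈ K) ∧ (∀ a, ε a ∈ K') ∧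
      (QuotientGroup.mk ((List.ofFn fun j => ⁅δ j, g j⁆).prod * (List.ofFn fun a => ⁅y a, ε a⁆).prod) :
        G ⧸ N) = QuotientGroup.mk ⁅k, c⁆ := by
  induction hc using Subgroup.closure_induction with
  | mem x hx =>
    obtain ⟨j, rfl⟩ := hx
    intro k hk
    exact layer_gslot g y K' K N hk j
  | one =>
    intro k hk
    rw [commutatorElement_one_right]
    exact layer_one g y K' K N
  | mul x x' _ _ hx hx' =>
    intro k hk
    have hkx' : ⁅k, x'⁆⁻¹ ∈ K := inv_mem (commutatorElement_mem_of_mem_normal K hk _)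
    have hid : ⁅k, x * x'⁆ = ⁅k, x⁆ * ⁅k, x'⁆ * ⁅⁅k, x'⁆⁻¹, x⁆ := by
      simp only [commutatorElement_def]; group
    rw [hid]
    exact layer_mul g y P K' K N hKP hK'P hy hKle hK'le
      (layer_mul g y P K' K N hKP hK'P hy hKle hK'le (hx k hk) (hx' k hk)) (hx _ hkx')
  | inv x _ hx =>
    intro k hk
    have hk' : x⁻¹ * k * x⁻¹⁻¹ ∈ K := Subgroup.Normal.conj_mem inferInstance _ hk _
    have hid : ⁅k, x⁻¹⁆ = ⁅x⁻¹ * k * x⁻¹⁻¹, x⁆⁻¹ := by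
      simp only [commutatorElement_def]; group
    rw [hid]
    exact layer_inv g y P K' K N hKP hK'P hy hKle hK'le (hx _ hk')

/-- Every element of `⁅K, G⁆` satisfies the layer predicate, provided the `gⱼ` generate `G`.
[cite: DixonDuSautoyMannSegal1999, Ch. 1 Prop. 1.16] -/
theorem layer_of_mem_commutator_top [P.Normal] (hKP : ∀ k ∈ K, ∀ x ∈ P, ⁅k, x⁆ ∈ N)
    (hK'P : ∀ w ∈ K', ∀ x ∈ P, ⁅w, x⁆ ∈ K) (hy : ∀ a, y a ∈ P) (hKle : K ≤ P) (hK'le : K' ≤ P)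
    (hg : Subgroup.closure (Set.range g) = ⊤) {z : G} (hz : z ∈ ⁅K, (⊤ : Subgroup G)⁆) :
    ∃ (δ : Fin d → G) (ε : Fin n → G), (∀ j, δ j ∈ K) ∧ (∀ a, ε a ∈ K') ∧
      (QuotientGroup.mk ((List.ofFn fun j => ⁅δ j, g j⁆).prod * (List.ofFn fun a => ⁅y a, ε a⁆).prod) :
        G ⧸ N) = QuotientGroup.mk z := by
  rw [Subgroup.commutator_def] at hz
  induction hz using Subgroup.closure_induction with
  | mem x hx =>
    obtain ⟨k, hk, c, -, rfl⟩ := hx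
    have hc : c ∈ Subgroup.closure (Set.range g) := by rw [hg]; exact Subgroup.mem_top c
    exact layer_commutator_of_mem_closure g y P K' K N hKP hK'P hy hKle hK'le hc k hk
  | one => exact layer_one g y K' K N
  | mul x x' _ _ hx hx' => exact layer_mul g y P K' K N hKP hK'P hy hKle hK'le hx hx'
  | inv x _ hx => exact layer_inv g y P K' K N hKP hK'P hy hKle hK'le hx

/-- The `P`-part: `⁅w, x⁆` satisfies the layer predicate for every `w ∈ K'` and every `x` in the
normal closure `P` of the `yₐ` (induction on `x` over the conjugates `c yₐ c⁻¹`, using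
`⁅w, c y c⁻¹⁆ = c ⁅c⁻¹ w c, y⁆ c⁻¹`, `c v c⁻¹ = v ⁅v⁻¹, c⁆`, `⁅w, x x'⁆ = ⁅w, x⁆ (x ⁅w, x'⁆ x⁻¹)` and
`⁅w, x⁻¹⁆ = x⁻¹ ⁅w, x⁆⁻¹ x`). [cite: DixonDuSautoyMannSegal1999, Ch. 1 Prop. 1.16] -/
theorem layer_commutator_of_mem_normalClosure [P.Normal] [K'.Normal] (hKP : ∀ k ∈ K, ∀ x ∈ P, ⁅k, x⁆ ∈ N)
    (hK'P : ∀ w ∈ K', ∀ x ∈ P, ⁅w, x⁆ ∈ K) (hy : ∀ a, y a ∈ P) (hKle : K ≤ P) (hK'le : K' ≤ P)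
    (hg : Subgroup.closure (Set.range g) = ⊤) (hP : Subgroup.normalClosure (Set.range y) = P)
    {x : G} (hx : x ∈ Subgroup.closure (Group.conjugatesOfSet (Set.range y))) :
    ∀ w ∈ K', ∃ (δ : Fin d → G) (ε : Fin n → G), (∀ j, δ j ∈ K) ∧ (∀ a, ε a ∈ K') ∧
      (QuotientGroup.mk ((List.ofFn fun j => ⁅δ j, g j⁆).prod * (List.ofFn fun a => ⁅y a, ε a⁆).prod) :
        G ⧸ N) = QuotientGroup.mk ⁅w, x⁆ := by
  induction hx using Subgroup.closure_induction with
  | mem x hx =>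
    -- `x = c (y a) c⁻¹`
    obtain ⟨y₀, ⟨a, rfl⟩, hconj⟩ := Group.mem_conjugatesOfSet_iff.mp hx
    obtain ⟨c, rfl⟩ := isConj_iff.mp hconj
    intro w hw
    have hw' : c⁻¹ * w * c⁻¹⁻¹ ∈ K' := Subgroup.Normal.conj_mem inferInstance _ hw _
    -- `v = ⁅c⁻¹ w c, y a⁆ = ⁅y a, c⁻¹ w c⁆⁻¹`
    have hv : ∃ (δ : Fin d → G) (ε : Fin n → G), (∀ j, δ j ∈ K) ∧ (∀ a, ε a ∈ K') ∧
        (QuotientGroup.mk ((List.ofFn fun j => ⁅δ j, g j⁆).prod *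
          (List.ofFn fun a => ⁅y a, ε a⁆).prod) : G ⧸ N) =
          QuotientGroup.mk ⁅c⁻¹ * w * c⁻¹⁻¹, y a⁆ := by
      rw [← commutatorElement_inv]
      exact layer_inv g y P K' K N hKP hK'P hy hKle hK'le (layer_yslot g y K' K N hw' a)
    have hvK : ⁅c⁻¹ * w * c⁻¹⁻¹, y a⁆ ∈ K := hK'P _ hw' _ (hy a)
    -- `c v c⁻¹ = v ⁅v⁻¹, c⁆`
    have hc : c ∈ Subgroup.closure (Set.range g) := by rw [hg]; exact Subgroup.mem_top c
    have hid : ⁅w, c * y a * c⁻¹⁆ =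
        ⁅c⁻¹ * w * c⁻¹⁻¹, y a⁆ * ⁅(⁅c⁻¹ * w * c⁻¹⁻¹, y a⁆)⁻¹, c⁆ := by
      simp only [commutatorElement_def]; group
    rw [hid]
    exact layer_mul g y P K' K N hKP hK'P hy hKle hK'le hv
      (layer_commutator_of_mem_closure g y P K' K N hKP hK'P hy hKle hK'le hc _ (inv_mem hvK))
  | one =>
    intro w hw
    rw [commutatorElement_one_right]
    exact layer_one g y K' K N
  | mul x x' hxm hx'm hx hx' =>
    intro w hw
    have hxP : x ∈ P := by rw [← hP]; exact hxm
    have hx'P : x' ∈ P := by rw [← hP]; exact hx'm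
    have hid : ⁅w, x * x'⁆ = ⁅w, x⁆ * (x * ⁅w, x'⁆ * x⁻¹) := by
      simp only [commutatorElement_def]; group
    rw [hid]
    obtain ⟨δ, ε, hδ, hε, e⟩ := hx' w hw
    refine layer_mul g y P K' K N hKP hK'P hy hKle hK'le (hx w hw) ⟨δ, ε, hδ, hε, ?_⟩
    rw [e, mk_conj_eq_of_commutator_le P K N hKP (hK'P _ hw _ hx'P) hxP]
  | inv x hxm hx =>
    intro w hw
    have hxP : x ∈ P := by rw [← hP]; exact hxm
    have hid : ⁅w, x⁻¹⁆ = x⁻¹ * ⁅w, x⁆⁻¹ * x⁻¹⁻¹ := by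
      simp only [commutatorElement_def]; group
    rw [hid]
    obtain ⟨δ, ε, hδ, hε, e⟩ := layer_inv g y P K' K N hKP hK'P hy hKle hK'le (hx w hw)
    refine ⟨δ, ε, hδ, hε, ?_⟩
    rw [e, mk_conj_eq_of_commutator_le P K N hKP (inv_mem (hK'P _ hw _ hxP)) (inv_mem hxP)]

/-- Every element of `⁅K', P⁆` satisfies the layer predicate.
[cite: DixonDuSautoyMannSegal1999, Ch. 1 Prop. 1.16] -/
theorem layer_of_mem_commutator [P.Normal] [K'.Normal] (hKP : ∀ k ∈ K, ∀ x ∈ P, ⁅k, x⁆ ∈ N)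
    (hK'P : ∀ w ∈ K', ∀ x ∈ P, ⁅w, x⁆ ∈ K) (hy : ∀ a, y a ∈ P) (hKle : K ≤ P) (hK'le : K' ≤ P)
    (hg : Subgroup.closure (Set.range g) = ⊤) (hP : Subgroup.normalClosure (Set.range y) = P)
    {z : G} (hz : z ∈ ⁅K', P⁆) :
    ∃ (δ : Fin d → G) (ε : Fin n → G), (∀ j, δ j ∈ K) ∧ (∀ a, ε a ∈ K') ∧
      (QuotientGroup.mk ((List.ofFn fun j => ⁅δ j, g j⁆).prod * (List.ofFn fun a => ⁅y a, ε a⁆).prod) :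
        G ⧸ N) = QuotientGroup.mk z := by
  rw [Subgroup.commutator_def] at hz
  induction hz using Subgroup.closure_induction with
  | mem x hx =>
    obtain ⟨w, hw, x, hx, rfl⟩ := hx
    have hx' : x ∈ Subgroup.closure (Group.conjugatesOfSet (Set.range y)) := by
      change x ∈ Subgroup.normalClosure (Set.range y)
      rw [hP]; exact hx
    exact layer_commutator_of_mem_normalClosure g y P K' K N hKP hK'P hy hKle hK'le hg hP hx' w hw
  | one => exact layer_one g y K' K N
  | mul x x' _ _ hx hx' => exact layer_mul g y P K' K N hKP hK'P hy hKle hK'le hx hx'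
  | inv x _ hx => exact layer_inv g y P K' K N hKP hK'P hy hKle hK'le hx

end Layer

/-! ### The theorems -/

section Main

variable {G : Type u} [Group G] {d n : ℕ} (g : Fin d → G) (y : Fin n → G) (P : Subgroup G)

/-- The word `W(s, u) = (∏ⱼ ⁅sⱼ, gⱼ⁆)(∏ₐ ⁅yₐ, uₐ⁆)` lies in `⁅P, G⁆` when `sⱼ, yₐ ∈ P`.
[cite: DixonDuSautoyMannSegal1999, Ch. 1 Prop. 1.16] -/
theorem word_mem_commutator_top (hy : ∀ a, y a ∈ P) (s : Fin d → G) (hs : ∀ j, s j ∈ P)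
    (u : Fin n → G) :
    (List.ofFn fun j => ⁅s j, g j⁆).prod * (List.ofFn fun a => ⁅y a, u a⁆).prod ∈
      ⁅P, (⊤ : Subgroup G)⁆ := by
  refine mul_mem (list_prod_mem fun c hc => ?_) (list_prod_mem fun c hc => ?_)
  · rw [List.mem_ofFn] at hc
    obtain ⟨j, rfl⟩ := hc
    exact Subgroup.commutator_mem_commutator (hs j) (Subgroup.mem_top _)
  · rw [List.mem_ofFn] at hc
    obtain ⟨a, rfl⟩ := hc
    exact Subgroup.commutator_mem_commutator (hy a) (Subgroup.mem_top _)

/-- **Operator commutator width.** Let `G` be generated by `g₁, …, g_d` and let `P ⊴ G` be a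
nilpotent normal subgroup which is the normal closure of `y₁, …, y_n ∈ P`.  Then every element of
`⁅P, G⁆` is `⁅s₁, g₁⁆ ⋯ ⁅s_d, g_d⁆ · ⁅y₁, u₁⁆ ⋯ ⁅y_n, u_n⁆` with all `sⱼ, uₐ ∈ P`.
[cite: DixonDuSautoyMannSegal1999, Ch. 1 Prop. 1.16] [cite: SerreGaloisCohomology1997, I §4.2 ex. 6] -/
theorem exists_eq_prod_commutator_of_normalClosure_eq [P.Normal] [Group.IsNilpotent P]
    (hg : Subgroup.closure (Set.range g) = ⊤) (hy : ∀ a, y a ∈ P)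
    (hP : Subgroup.normalClosure (Set.range y) = P) {c : G} (hc : c ∈ ⁅P, (⊤ : Subgroup G)⁆) :
    ∃ (s : Fin d → G) (u : Fin n → G), (∀ j, s j ∈ P) ∧ (∀ a, u a ∈ P) ∧
      c = (List.ofFn fun j => ⁅s j, g j⁆).prod * (List.ofFn fun a => ⁅y a, u a⁆).prod := by
  -- `key k`: `c ≡ W(s, u) (mod γ_k(P))`
  have key : ∀ k : ℕ, ∃ (s : Fin d → G) (u : Fin n → G), (∀ j, s j ∈ P) ∧ (∀ a, u a ∈ P) ∧
      ((List.ofFn fun j => ⁅s j, g j⁆).prod * (List.ofFn fun a => ⁅y a, u a⁆).prod)⁻¹ * c ∈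
        P.lowerCentralSeries k := by
    intro k
    induction k with
    | zero =>
      refine ⟨fun _ => 1, fun _ => 1, fun _ => one_mem _, fun _ => one_mem _, ?_⟩
      simp only [commutatorElement_one_left, commutatorElement_one_right, List.ofFn_const,
        List.prod_replicate, one_pow, mul_one, inv_one, one_mul, Subgroup.lowerCentralSeries_zero]
      exact Subgroup.commutator_le_left P (⊤ : Subgroup G) hc
    | succ k ih =>
      obtain ⟨s, u, hs, hu, he⟩ := ih
      -- the layer data: `K' = γ_{k-1}`, `K = γ_k`, `N = γ_{k+1}`
      haveI hN : (P.lowerCentralSeries (k + 1)).Normal := normal_lowerCentralSeries P (k + 1)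
      haveI hK : (P.lowerCentralSeries k).Normal := normal_lowerCentralSeries P k
      haveI hK' : (P.lowerCentralSeries (k - 1)).Normal := normal_lowerCentralSeries P (k - 1)
      have hKP : ∀ w ∈ P.lowerCentralSeries k, ∀ x ∈ P, ⁅w, x⁆ ∈ P.lowerCentralSeries (k + 1) :=
        fun w hw x hx => commutatorElement_mem_lowerCentralSeries_succ' P k hw hx
      have hK'P : ∀ w ∈ P.lowerCentralSeries (k - 1), ∀ x ∈ P, ⁅w, x⁆ ∈ P.lowerCentralSeries k :=
        fun w hw x hx => commutatorElement_mem_lowerCentralSeries_of_pred P k hw hx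
      have hKle : P.lowerCentralSeries k ≤ P := lowerCentralSeries_le_self P k
      have hK'le : P.lowerCentralSeries (k - 1) ≤ P := lowerCentralSeries_le_self P (k - 1)
      -- the error term satisfies the layer predicate
      set e := ((List.ofFn fun j => ⁅s j, g j⁆).prod * (List.ofFn fun a => ⁅y a, u a⁆).prod)⁻¹ * c
        with he_def
      have hlayer : ∃ (δ : Fin d → G) (ε : Fin n → G), (∀ j, δ j ∈ P.lowerCentralSeries k) ∧
          (∀ a, ε a ∈ P.lowerCentralSeries (k - 1)) ∧
          (QuotientGroup.mk ((List.ofFn fun j => ⁅δ j, g j⁆).prod *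
            (List.ofFn fun a => ⁅y a, ε a⁆).prod) : G ⧸ P.lowerCentralSeries (k + 1)) =
            QuotientGroup.mk e := by
        rcases k with _ | k
        · -- layer `0`: `e ∈ ⁅P, G⁆`
          have he0 : e ∈ ⁅P.lowerCentralSeries 0, (⊤ : Subgroup G)⁆ := by
            rw [Subgroup.lowerCentralSeries_zero]
            exact mul_mem (inv_mem (word_mem_commutator_top g y P hy s hs u)) hc
          exact layer_of_mem_commutator_top g y P (P.lowerCentralSeries (0 - 1)) (P.lowerCentralSeries 0)
            (P.lowerCentralSeries (0 + 1)) hKP hK'P hy hKle hK'le hg he0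
        · -- layer `k + 1`: `e ∈ γ_{k+1}(P) = ⁅γ_k(P), P⁆`
          have he1 : e ∈ ⁅P.lowerCentralSeries (k + 1 - 1), P⁆ := by
            rw [Nat.add_sub_cancel, ← Subgroup.lowerCentralSeries_succ]; exact he
          exact layer_of_mem_commutator g y P (P.lowerCentralSeries (k + 1 - 1))
            (P.lowerCentralSeries (k + 1)) (P.lowerCentralSeries (k + 1 + 1)) hKP hK'P hy hKle hK'le hg
            hP he1
      obtain ⟨δ, ε, hδ, hε, hw⟩ := hlayer
      refine ⟨fun j => s j * δ j, fun a => u a * ε a, fun j => mul_mem (hs j) (hKle (hδ j)),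
        fun a => mul_mem (hu a) (hK'le (hε a)), ?_⟩
      rw [← QuotientGroup.eq, mk_word_mul g y P (P.lowerCentralSeries (k - 1)) (P.lowerCentralSeries k)
        (P.lowerCentralSeries (k + 1)) hKP hK'P hy s δ hs hδ u ε hu hε, hw, ← QuotientGroup.mk_mul,
        he_def, mul_inv_cancel_left]
  -- `P` nilpotent: some `γ_k(P)` is trivial
  obtain ⟨k, hk⟩ := (Subgroup.isNilpotent_iff_lowerCentralSeries P).mp inferInstance
  obtain ⟨s, u, hs, hu, he⟩ := key k
  refine ⟨s, u, hs, hu, ?_⟩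
  rw [hk, Subgroup.mem_bot, inv_mul_eq_one] at he
  exact he.symm

/-- In a group `G`, modulo a normal subgroup `C` containing `⁅P, G⁆`, every element of the subgroup
generated by the `p`-th powers of elements of `P` and the commutators `⁅x, g⁆` (`x ∈ P`) is a
`p`-th power of an element of `P`. [cite: DixonDuSautoyMannSegal1999, Ch. 1 Prop. 1.16] -/
theorem exists_mem_mul_pow_of_mem_closure (p : ℕ) [P.Normal] {t : G}
    (ht : t ∈ Subgroup.closure
      ({x : G | ∃ w ∈ P, w ^ p = x} ∪ {x : G | ∃ w ∈ P, ∃ c : G, ⁅w, c⁆ = x})) :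
    ∃ c ∈ ⁅P, (⊤ : Subgroup G)⁆, ∃ w ∈ P, t = c * w ^ p := by
  set C : Subgroup G := ⁅P, (⊤ : Subgroup G)⁆ with hC
  haveI : C.Normal := by rw [hC]; infer_instance
  -- elements of `P` commute modulo `C ⊇ ⁅P, P⁆`
  have hcomm : ∀ {w w' : G}, w ∈ P → w' ∈ P →
      (QuotientGroup.mk w : G ⧸ C) * QuotientGroup.mk w' = QuotientGroup.mk w' * QuotientGroup.mk w :=
    fun hw hw' => mk_mul_mk_comm_of_commutator_le P P C
      (fun k hk x _ => Subgroup.commutator_mem_commutator hk (Subgroup.mem_top x)) hw hw'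
  -- modulo `C`, `t` is the `p`-th power of an element of `P`
  have key : ∃ w ∈ P, (QuotientGroup.mk t : G ⧸ C) = QuotientGroup.mk (w ^ p) := by
    induction ht using Subgroup.closure_induction with
    | mem x hx =>
      rcases hx with ⟨w, hw, rfl⟩ | ⟨w, hw, c, rfl⟩
      · exact ⟨w, hw, rfl⟩
      · refine ⟨1, one_mem _, ?_⟩
        rw [one_pow, QuotientGroup.eq, mul_one]
        exact inv_mem (Subgroup.commutator_mem_commutator hw (Subgroup.mem_top c))
    | one => exact ⟨1, one_mem _, by rw [one_pow]⟩
    | mul x x' _ _ hx hx' =>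
      obtain ⟨w, hw, e⟩ := hx
      obtain ⟨w', hw', e'⟩ := hx'
      refine ⟨w * w', mul_mem hw hw', ?_⟩
      rw [QuotientGroup.mk_mul, e, e', QuotientGroup.mk_pow, QuotientGroup.mk_pow, QuotientGroup.mk_pow,
        QuotientGroup.mk_mul, (Commute.mul_pow (hcomm hw hw'))]
    | inv x _ hx =>
      obtain ⟨w, hw, e⟩ := hx
      refine ⟨w⁻¹, inv_mem hw, ?_⟩
      rw [QuotientGroup.mk_inv, e, QuotientGroup.mk_pow, QuotientGroup.mk_pow, QuotientGroup.mk_inv,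
        inv_pow]
  obtain ⟨w, hw, e⟩ := key
  refine ⟨t * (w ^ p)⁻¹, ?_, w, hw, by rw [inv_mul_cancel_right]⟩
  rw [← QuotientGroup.eq_one_iff, QuotientGroup.mk_mul, QuotientGroup.mk_inv, e, mul_inv_cancel]

/-- **Shape of the operator Frattini words.** Let `G` be generated by `g₁, …, g_d` and let
`P ⊴ G` be a nilpotent normal subgroup which is the normal closure of `y₁, …, y_n ∈ P`.  Then
every element of the subgroup generated by the `p`-th powers of elements of `P` and the
commutators `⁅x, c⁆` (`x ∈ P`, `c ∈ G`) is of the shape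
`⁅s₁, g₁⁆ ⋯ ⁅s_d, g_d⁆ · ⁅y₁, u₁⁆ ⋯ ⁅y_n, u_n⁆ · w ^ p` with all `sⱼ, uₐ, w ∈ P`.  (For a finite
`p`-group `P` this is the uniform bound behind the operator form of Serre's theorem.)
[cite: DixonDuSautoyMannSegal1999, Ch. 1 Prop. 1.16–1.19] [cite: SerreGaloisCohomology1997, I §4.2 ex. 6] -/
theorem exists_eq_prod_commutator_mul_pow_of_normalClosure_eq (p : ℕ) [P.Normal] [Group.IsNilpotent P]
    (hg : Subgroup.closure (Set.range g) = ⊤) (hy : ∀ a, y a ∈ P)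
    (hP : Subgroup.normalClosure (Set.range y) = P) {t : G}
    (ht : t ∈ Subgroup.closure
      ({x : G | ∃ w ∈ P, w ^ p = x} ∪ {x : G | ∃ w ∈ P, ∃ c : G, ⁅w, c⁆ = x})) :
    ∃ (s : Fin d → G) (u : Fin n → G) (w : G), (∀ j, s j ∈ P) ∧ (∀ a, u a ∈ P) ∧ w ∈ P ∧
      t = (List.ofFn fun j => ⁅s j, g j⁆).prod * (List.ofFn fun a => ⁅y a, u a⁆).prod * w ^ p := by
  obtain ⟨c, hc, w, hw, rfl⟩ := exists_mem_mul_pow_of_mem_closure P p ht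
  obtain ⟨s, u, hs, hu, rfl⟩ := exists_eq_prod_commutator_of_normalClosure_eq g y P hg hy hP hc
  exact ⟨s, u, w, hs, hu, hw, rfl⟩

end Main

end Literature.GroupTheory.Nilpotent

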